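import Literature.MathematicalPhysics.QuantumFieldTheory.ConformalBootstrap3D.DualFunctional

/-!
# Sanity lemmas for `CrossingFunctional.identityTerm` (pub-ising3x REVIEW-RUNBOOK, card `identityTerm`)

Review evidence only (ops-runbook sanity registry `registry/pub-ising3x.json`); no new definitions.
`identityTerm α Δσ Δε = α¹[F^{σσ,σσ}_{-,𝟙}] + α²[F^{εε,εε}_{-,𝟙}] + α⁴[F^{σσ,εε}_{-,𝟙}] + α⁵[F^{σσ,εε}_{+,𝟙}]`
with the unit block `g ≡ 1` (`Literature/…/ConformalBootstrap3D/DualFunctional.lean`).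

* the zero functional contributes `0` (the term is linear in `α`);
* at the crossing-symmetric point `z = z̄ = 1/2` the three `F₋` identity contributions VANISH and the `F₊`
  one is `2·(1/4)^{(Δσ+Δε)/2}`: for every functional whose components are point evaluation at `(1/2, 1/2)`
  the identity term is `2·(1/4)^{(Δσ+Δε)/2} > 0` — explicit, non-zero; such a functional exists
  (Mathlib's `LinearMap.proj` twice), so the definition is not degenerate.
-/

namespace Summit.CriticalPhenomena.Ising3D.Runbook

open Literature.MathematicalPhysics.QuantumFieldTheory.ConformalBootstrap3D

/-- `F_{-}` of the unit block vanishes at the crossing-symmetric point `z = z̄ = 1/2` (any prefactor exponent). -/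
theorem crossF_neg_unit_half (s : ℝ) : crossF s (-1) (fun _ _ => (1 : ℝ)) (1 / 2) (1 / 2) = 0 := by
  simp only [crossF]
  norm_num

/-- `F_{+}` of the unit block at `z = z̄ = 1/2` is `2 · (1/4)^s`. -/
theorem crossF_pos_unit_half (s : ℝ) :
    crossF s 1 (fun _ _ => (1 : ℝ)) (1 / 2) (1 / 2) = 2 * (1 / 4 : ℝ) ^ s := by
  simp only [crossF]
  norm_num
  ring

/-- The zero functional has identity term `0`. -/
theorem identityTerm_zero (Δσ Δε : ℝ) : CrossingFunctional.identityTerm ⟨0, 0, 0, 0, 0⟩ Δσ Δε = 0 := by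
  simp [CrossingFunctional.identityTerm]

/-- For a functional whose components `α¹, α², α⁴, α⁵` are point evaluation at `(1/2, 1/2)`, the identity
term is the explicit positive number `2·(1/4)^{(Δσ+Δε)/2}` (only the `F₊` rule contributes). -/
theorem identityTerm_of_eval_half (α : CrossingFunctional) (Δσ Δε : ℝ)
    (h₁ : ∀ g, α.α₁ g = g (1 / 2) (1 / 2)) (h₂ : ∀ g, α.α₂ g = g (1 / 2) (1 / 2))
    (h₄ : ∀ g, α.α₄ g = g (1 / 2) (1 / 2)) (h₅ : ∀ g, α.α₅ g = g (1 / 2) (1 / 2)) :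
    α.identityTerm Δσ Δε = 2 * (1 / 4 : ℝ) ^ ((Δσ + Δε) / 2) := by
  simp only [CrossingFunctional.identityTerm, h₁, h₂, h₄, h₅, crossF_neg_unit_half, crossF_pos_unit_half]
  ring

/-- That value is positive — the identity term of such a functional is non-zero. -/
theorem identityTerm_of_eval_half_pos (α : CrossingFunctional) (Δσ Δε : ℝ)
    (h₁ : ∀ g, α.α₁ g = g (1 / 2) (1 / 2)) (h₂ : ∀ g, α.α₂ g = g (1 / 2) (1 / 2))
    (h₄ : ∀ g, α.α₄ g = g (1 / 2) (1 / 2)) (h₅ : ∀ g, α.α₅ g = g (1 / 2) (1 / 2)) :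
    0 < α.identityTerm Δσ Δε := by
  rw [identityTerm_of_eval_half α Δσ Δε h₁ h₂ h₄ h₅]
  positivity

/-- Such a functional exists: all five components = point evaluation at `(1/2, 1/2)` (Mathlib `LinearMap.proj`
composed twice). Hence `identityTerm` takes a non-zero value. -/
theorem exists_identityTerm_ne_zero (Δσ Δε : ℝ) : ∃ α : CrossingFunctional, α.identityTerm Δσ Δε ≠ 0 := by
  let e : (ℝ → ℝ → ℝ) →ₗ[ℝ] ℝ :=
    (LinearMap.proj (1 / 2 : ℝ) : (ℝ → ℝ) →ₗ[ℝ] ℝ).comp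
      (LinearMap.proj (1 / 2 : ℝ) : (ℝ → ℝ → ℝ) →ₗ[ℝ] (ℝ → ℝ))
  have he : ∀ g, e g = g (1 / 2) (1 / 2) := fun g => rfl
  exact ⟨⟨e, e, e, e, e⟩, (identityTerm_of_eval_half_pos ⟨e, e, e, e, e⟩ Δσ Δε he he he he).ne'⟩

end Summit.CriticalPhenomena.Ising3D.Runbook
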